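import Summits.AnomalousDissipation.AnomalousDissipation.Theorems.SawtoothPulseCascadeK1LocalisedCascadeChirpSidebandEnergy
import Summits.AnomalousDissipation.AnomalousDissipation.Theorems.SawtoothPulseCascadeK1LocalisedCascadeFibreWindowSieve

/-!
# K1loc, line `Spectral` / thin start — helper: THE HALF-STEP WINDOW INEQUALITY, PERIODIC-SIEVE FORM (S-D, «HalfStepSieve»)

Helper file of the prover lane on the crux `K1LocalisedCascade` (stmt-AnomalousDissipation-19491), route
`SawtoothPulseCascade` (S-D fibre ledger).  The sup-free twin of `…HalfStepL2.sum_window_sq_norm_halfStep_twist_L2_le`, for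
both half-steps (`Φ = shearMap i i′ (γU_j)`, `i ≠ i′`) and a generic continuous input `b` with absolutely summable coefficients:
same data (input cut-off `χ` with `χ(l) ≠ 0 → |l| < L`, per-fibre multipliers `ψ_n` with plateau and notch, reduced strains
`N_j·λ′_n = nG`), but the hypothesis `‖A^i_nT‖ ≤ S_n` on the tracked part `T = Σ_l χ(l)A^{i′}_l b` is GONE: the spectrum of
`T` lies in the slab `|k_{i′}| ≤ L − 1`, the cut-offs `ψ_n ⋆ twist(γU_j) n` are `1/N_j`-periodic (`U_j` has `N_j` identical
teeth, `U_add_one_div_N`), and `…FibreWindowSieve.sum_window_sq_norm_comp_shearMap_le_sieve` applies: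
**`sum_window_sq_norm_halfStep_twist_sieve_le`** —
`Σ_{k∈W}‖𝓕(b∘Φ)(k)‖² ≤ (√((1 + 2(L−1)/N_j)·Σ_{n∈F} E_n·∫‖A^i_nT‖²) + √(Σ_{n∈F}∫‖A^i_n(b − T)‖²))²`,
`E_n = (√((8/π²)/(D′_n−1)) + |n|G(2e^{1/2}−1)δ_j/N_j)²` (`…ChirpSidebandEnergy`) — the junk is RELATIVE to the tracked
`L²` energy `Σ_n∫‖A^i_nT‖² ≤ ‖T‖₂²`, with no sup norm anywhere.
No definitions; no statement about the crux. [cite: Grafakos2014, Prop. 3.1.2 (5) and Prop. 3.2.7 (3)] [problem: turb]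
-/

-- `Summit.<Summit>.<Problem>`: single-conjunct summit, the duplicate namespace segment is deliberate.
set_option linter.dupNamespace false

noncomputable section

namespace Summit.AnomalousDissipation.AnomalousDissipation.Theorems.SawtoothPulseCascade.K1Window

open MeasureTheory Set Filter Topology UnitAddTorus Function Complex
open scoped Real
open Literature.Analysis Literature.Analysis.FunctionSpaces Literature.Analysis.FunctionSpaces.Torus Literature.Analysis.FluidPDE
open Literature.Analysis.FluidPDE.ShearStage
open Literature.Analysis.FluidPDE.SawtoothCascade Literature.Analysis.FluidPDE.SawtoothCascade.CascadeParams
open Summit.AnomalousDissipation.AnomalousDissipation.Theorems.SawtoothPulseCascade.K1Start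

/-! ## Periodicity of the phase-`j` profile and of the twist cut-offs -/

/-- The phase-`j` profile has `N_j` identical teeth: `U_j(y + 1/N_j) = U_j(y)` (`N_j ≥ 1`).
[cite: ElgindiLissMattingly2025, §1 (H_α, V_α on 𝕋²)] -/
theorem U_add_one_div_N (P : CascadeParams) {j : ℕ} (hN : 0 < P.N j) (y : ℝ) :
    P.U j (y + 1 / P.N j) = P.U j y := by
  have hNr : (P.N j : ℝ) ≠ 0 := by exact_mod_cast hN.ne'
  simp only [CascadeParams.U]
  rw [show 2 * Real.pi * (P.N j : ℝ) * (y + 1 / P.N j) = 2 * Real.pi * P.N j * y + 2 * Real.pi by field_simp,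
    roundedSaw_periodic]

/-- The chirps of the phase-`j` profile are `1/N_j`-periodic on the circle: `twist(γU_j) n (z + 1/N_j) = twist(γU_j) n z`.
[cite: ElgindiLissMattingly2025, §1 (H_α, V_α on 𝕋²)] -/
theorem twist_amp_U_add_one_div_N (P : CascadeParams) (hδ₀ : 0 < P.δ₀) (hd : 0 < P.d) {j : ℕ} (hN : 0 < P.N j)
    (n : ℤ) (z : UnitAddCircle) :
    twist (amp ⟨P.U j, P.U_periodic j, P.contDiff_U (P.δ_pos hδ₀ hd j)⟩ P.γ) n
        (z + (((1 : ℝ) / P.N j : ℝ) : UnitAddCircle)) =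
      twist (amp ⟨P.U j, P.U_periodic j, P.contDiff_U (P.δ_pos hδ₀ hd j)⟩ P.γ) n z := by
  obtain ⟨t, rfl⟩ := QuotientAddGroup.mk_surjective z
  have hx : (QuotientAddGroup.mk t : UnitAddCircle) = ((t : ℝ) : UnitAddCircle) := rfl
  rw [hx, ← AddCircle.coe_add, twist_coe, twist_coe]
  have h1 : amp ⟨P.U j, P.U_periodic j, P.contDiff_U (P.δ_pos hδ₀ hd j)⟩ P.γ (t + 1 / P.N j) = P.γ * P.U j (t + 1 / P.N j) :=
    rfl
  have h2 : amp ⟨P.U j, P.U_periodic j, P.contDiff_U (P.δ_pos hδ₀ hd j)⟩ P.γ t = P.γ * P.U j t := rfl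
  rw [h1, h2, U_add_one_div_N P hN]

/-- A circle cut-off of a `p`-periodic function is `p`-periodic. [folklore] -/
theorem circleCutoff_add_of_periodic {k g : UnitAddCircle → ℂ} {p : UnitAddCircle} (hg : ∀ z, g (z + p) = g z)
    (y : UnitAddCircle) :
    ∫ s : UnitAddCircle, k s * g (y + p + s) = ∫ s : UnitAddCircle, k s * g (y + s) := by
  refine integral_congr_ae (Eventually.of_forall fun s => ?_)
  simp only
  rw [add_right_comm, hg]

/-! ## The half-step window inequality, periodic-sieve form -/

/-- **THE HALF-STEP WINDOW INEQUALITY, PERIODIC-SIEVE FORM** (see the file header).  Data: cascade parameters (`γ = G ∈ ℕ`,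
`δ₀ > 0`, `d > 0`, phase `j` with `N_j ≥ 1`), axes `i ≠ i′`, a continuous input `b` with absolutely summable coefficients, a
finite window `W`, the input cut-off `χ` (support `Sχ`, `‖χ‖ ≤ 1`, `χ(l) ≠ 0 → |l| < L`), per-fibre multipliers `ψ_n`
(support `Sψ n`, `‖ψ_n‖ ≤ 1` there, plateau `ψ_{k_i}(k_{i′} − l) = 1` for `k ∈ W`, `|l| < L`), reduced strains `λ′` with
`N_j·λ′(k_i) = k_i·G` on `W`, notch widths `D′ ≥ 2` with `N_j·D′(k_i) ≤ |m ± k_iG|` for the multiples `m ∈ Sψ(k_i)` of `N_j`.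
Then, with `T = Σ_l χ(l)A^{i′}_l b` and `E_n = (√((8/π²)/(D′_n−1)) + |n|G(2e^{1/2}−1)δ_j/N_j)²`,
`Σ_{k∈W}‖𝓕(b∘shearMap i i′ (γU_j))(k)‖² ≤ (√((1 + 2(L−1)/N_j)·Σ_{n∈F}E_n∫‖A^i_nT‖²) + √(Σ_{n∈F}∫‖A^i_n(b − T)‖²))²`.
[cite: Grafakos2014, Prop. 3.1.2 (5) and Prop. 3.2.7 (3)] -/
theorem sum_window_sq_norm_halfStep_twist_sieve_le (P : CascadeParams) {G : ℕ} (hγ : P.γ = G) (hδ₀ : 0 < P.δ₀)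
    (hd : 0 < P.d) {j : ℕ} (hN : 0 < P.N j) {i i' : Fin 2} (hii' : i ≠ i')
    {b : UnitAddTorus (Fin 2) → ℂ} (hb : Continuous b) (hbs : Summable fun k => ‖mFourierCoeff b k‖)
    (W : Finset (Fin 2 → ℤ)) (χ : ℤ → ℂ) (Sχ : Finset ℤ) (hχS : ∀ l, l ∉ Sχ → χ l = 0) (hχ1 : ∀ l, ‖χ l‖ ≤ 1)
    (L : ℕ) (hχL : ∀ l, χ l ≠ 0 → |l| < L) (ψ : ℤ → ℤ → ℂ) (Sψ : ℤ → Finset ℤ)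
    (hψS : ∀ n m, m ∉ Sψ n → ψ n m = 0) (hψb : ∀ n, ∀ m ∈ Sψ n, ‖ψ n m‖ ≤ 1)
    (hψ1 : ∀ k ∈ W, ∀ l : ℤ, |l| < L → ψ (k i) (k i' - l) = 1)
    (lam' : ℤ → ℤ) (hlam : ∀ k ∈ W, (P.N j : ℤ) * lam' (k i) = k i * G)
    (D' : ℤ → ℕ) (hD' : ∀ k ∈ W, 2 ≤ D' (k i))
    (hnotch : ∀ k ∈ W, ∀ m ∈ Sψ (k i), (P.N j : ℤ) ∣ m →
      (P.N j : ℤ) * D' (k i) ≤ |m + k i * G| ∧ (P.N j : ℤ) * D' (k i) ≤ |m - k i * G|) :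
    ∑ k ∈ W, ‖mFourierCoeff (b ∘ shearMap i i' (amp ⟨P.U j, P.U_periodic j, P.contDiff_U (P.δ_pos hδ₀ hd j)⟩ P.γ)) k‖ ^ 2 ≤
      (Real.sqrt ((1 + 2 * ((L - 1 : ℕ) : ℝ) / P.N j) * ∑ n ∈ W.image (fun k => k i),
          (Real.sqrt (8 / π ^ 2 * (1 / ((D' n : ℝ) - 1))) +
              |(n : ℝ)| * G * ((2 * Real.exp (1 / 2) - 1) * P.δ j / P.N j)) ^ 2 *
            ∫ x : UnitAddTorus (Fin 2), ‖∫ s : UnitAddCircle, (fourier (-n) s : ℂ) •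
              (∑ l ∈ Sχ, χ l * ∫ s' : UnitAddCircle,
                (fourier (-l) s' : ℂ) • b (x + Pi.single i s + Pi.single i' s'))‖ ^ 2) +
        Real.sqrt (∑ n ∈ W.image (fun k => k i), ∫ x : UnitAddTorus (Fin 2),
          ‖∫ s : UnitAddCircle, (fourier (-n) s : ℂ) •
            (b (x + Pi.single i s) - ∑ l ∈ Sχ, χ l * ∫ s' : UnitAddCircle,
              (fourier (-l) s' : ℂ) • b (x + Pi.single i s + Pi.single i' s'))‖ ^ 2)) ^ 2 := by
  classical
  set Ψ : ShearProfile := amp ⟨P.U j, P.U_periodic j, P.contDiff_U (P.δ_pos hδ₀ hd j)⟩ P.γ with hΨ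
  -- the tracked part of the input and the remainder
  set T : UnitAddTorus (Fin 2) → ℂ := fun x => ∑ l ∈ Sχ, χ l *
    ∫ s : UnitAddCircle, (fourier (-l) s : ℂ) • b (x + Pi.single i' s) with hT
  have hTc : Continuous T :=
    continuous_finsetSum _ fun l _ => continuous_const.mul (continuous_twistedAxisAvg hb i' l)
  have hTcoef : ∀ k, mFourierCoeff T k = χ (k i') * mFourierCoeff b k := fun k => mFourierCoeff_axisCutoff hb i' hχS k
  have hTs : Summable fun k => ‖mFourierCoeff T k‖ := by
    refine Summable.of_nonneg_of_le (fun k => norm_nonneg _) (fun k => ?_) hbs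
    rw [hTcoef k, norm_mul]
    exact mul_le_of_le_one_left (norm_nonneg _) (hχ1 _)
  -- the spectrum of `T` lies in the slab `|k_{i′}| ≤ L − 1`
  have hTK : ∀ k, mFourierCoeff T k ≠ 0 → |k i'| ≤ ((L - 1 : ℕ) : ℤ) := by
    intro k hk
    rw [hTcoef k] at hk
    have hχ0 : χ (k i') ≠ 0 := fun h => hk (by rw [h, zero_mul])
    have hl : |k i'| < L := hχL _ hχ0
    have hL1 : 1 ≤ L := by
      by_contra h0
      have : L = 0 := by omega
      rw [this] at hl
      exact absurd hl (by push_cast; exact not_lt.2 (abs_nonneg _))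
    rw [Nat.cast_sub hL1]
    push_cast
    omega
  set θ₂ : UnitAddTorus (Fin 2) → ℂ := fun x => b x - T x with hθ₂
  have hθ₂c : Continuous θ₂ := hb.sub hTc
  have hsum : (fun x => T x + θ₂ x) = b := by funext x; simp [hθ₂]
  -- the circle kernels and the twist cut-off
  set kψ : ℤ → UnitAddCircle → ℂ := fun n s => ∑ m ∈ Sψ n, ψ n m * fourier (-m) s with hkψ
  have hkψc : ∀ n, Continuous (kψ n) := fun n =>
    continuous_finsetSum _ fun m _ => continuous_const.mul (fourier (-m)).continuous
  set gmid : ℤ → UnitAddCircle → ℂ := fun n bb => ∫ s : UnitAddCircle, kψ n s * twist Ψ n (bb + s) with hgmid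
  set grest : ℤ → UnitAddCircle → ℂ := fun n bb => twist Ψ n bb - ∫ s : UnitAddCircle, kψ n s * twist Ψ n (bb + s)
    with hgrest
  have hgmidc : ∀ n, Continuous (gmid n) := fun n => continuous_circleCutoff (hkψc n) (continuous_twist Ψ n)
  have hgrestc : ∀ n, Continuous (grest n) := fun n =>
    (continuous_twist Ψ n).sub (continuous_circleCutoff (hkψc n) (continuous_twist Ψ n))
  have hsplit : ∀ k ∈ W, ∀ bb, twist Ψ (k i) bb = gmid (k i) bb + grest (k i) bb := by
    intro k _ bb; simp only [hgmid, hgrest]; ring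
  -- the cut-offs are `1/N_j`-periodic
  have hper : ∀ n (y : UnitAddCircle), gmid n (y + (((1 : ℝ) / P.N j : ℝ) : UnitAddCircle)) = gmid n y := by
    intro n y
    simp only [hgmid]
    exact circleCutoff_add_of_periodic (twist_amp_U_add_one_div_N P hδ₀ hd hN n) y
  -- exact separation
  have hsep : ∀ k ∈ W, ∀ m : ℤ, fourierCoeff (grest (k i)) m * mFourierCoeff T (k - Pi.single i' m) = 0 := by
    intro k hk m
    rw [hTcoef]
    have e0 : (k - Pi.single i' m : Fin 2 → ℤ) i' = k i' - m := by simp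
    rw [e0]
    by_cases hχ0 : χ (k i' - m) = 0
    · rw [hχ0, zero_mul, mul_zero]
    · have hl : |k i' - m| < L := hχL _ hχ0
      have hψm : ψ (k i) m = 1 := by
        have := hψ1 k hk (k i' - m) hl
        rwa [show k i' - (k i' - m) = m by ring] at this
      have hcoef : fourierCoeff (grest (k i)) m = 0 := by
        simp only [hgrest]
        rw [fourierCoeff_sub_of_continuous (continuous_twist Ψ _)
            (continuous_circleCutoff (hkψc _) (continuous_twist Ψ _)),
          show (fun y : UnitAddCircle => ∫ s : UnitAddCircle, kψ (k i) s * twist Ψ (k i) (y + s)) =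
            (fun y : UnitAddCircle => ∫ s : UnitAddCircle, (∑ m' ∈ Sψ (k i), ψ (k i) m' * fourier (-m') s) *
              twist Ψ (k i) (y + s)) from rfl,
          fourierCoeff_circleCutoff (continuous_twist Ψ _) (hψS (k i)) m, hψm, one_mul, sub_self]
      rw [hcoef, zero_mul]
  -- the mid-band energy from `…ChirpSidebandEnergy`
  set E : ℤ → ℝ := fun n => (Real.sqrt (8 / π ^ 2 * (1 / ((D' n : ℝ) - 1))) +
    |(n : ℝ)| * G * ((2 * Real.exp (1 / 2) - 1) * P.δ j / P.N j)) ^ 2 with hEdef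
  have hE : ∀ k ∈ W, ∫ bb : UnitAddCircle, ‖gmid (k i) bb‖ ^ 2 ≤ E (k i) := by
    intro k hk
    exact integral_norm_sq_circleCutoff_twist_cascade_le P hδ₀ hd hN hγ (k i) (lam' (k i)) (hlam k hk)
      (hψS (k i)) (hψb (k i)) (hD' k hk) (hnotch k hk)
  -- the window lemma, periodic-sieve form
  have hmain := sum_window_sq_norm_comp_shearMap_le_sieve hTc hTs hθ₂c hii' hTK Ψ W gmid grest hgmidc hgrestc hsplit hsep
    hN hper (E := E) hE
  rw [hsum] at hmain
  exact hmain

end Summit.AnomalousDissipation.AnomalousDissipation.Theorems.SawtoothPulseCascade.K1Window
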